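import Literature.Geometry.Riemannian.CurveTubeMap
import Literature.Geometry.Riemannian.NormalCoordinatesCenter
import Literature.Geometry.Lorentzian.PPCurvatureSingularity
import Literature.Geometry.Lorentzian.GeodesicSpeed
import HarnessLib

/-!
# Second-order data of the tube map on the axis (Lee 2018, Prop. 5.26 (d)–(e))

Topic `Geometry/Riemannian`. Continuing `CurveTubeMap.lean` (`Φ(v) = exp_{c(ℓ v)}(e(ℓ v)(v - (ℓ v)ε₀))`,
`dΦ = e` on the axis) and `NormalCoordinatesCenter.lean` (`D_u d(exp_y)_{ua}(b)|₀ = 0`). The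
first derivatives of the pulled-back metric `G_v(u, w) = g(dΦ_v u, dΦ_v w)` are, by metric
compatibility along the curve `s ↦ Φ(v + sz)`,
`∂_z G(u, w) = g(D_s(dΦ u), dΦ w) + g(dΦ u, D_s(dΦ w))` (`hasDerivAt_val_mfderiv_tubeMap`), where
`D_s(dΦ_{v+sz} u)|₀` is the covariant derivative `D_s ∂_t x(0, 0)` of the two-parameter map
`x(s, t) = Φ(v + sz + tu)`. On the axis `v = x₁ε₀` these are:

* `covariantDerivAlong_mfderiv_tubeMap_axis_normal_normal` — **`0` for `z, u ⊥ ε₀`**: the slice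
  `(s, t) ↦ Φ(x₁ε₀ + sz + tu) = exp_{c x₁}(s e z + t e u)` is a normal chart of the fibre
  (Lee 5.26 (d): `Γᵏᵢⱼ = 0` for normal indices);
* `covariantDerivAlong_mfderiv_tubeMap_axis_unit_normal` — **`D_t(e u)(x₁)` for `z = ε₀`,
  `u ⊥ ε₀`** (along the axis `dΦ(u) = e(·) u`);
* `covariantDerivAlong_mfderiv_tubeMap_axis_unit_unit` — **`D_t c'(x₁)` for `z = u = ε₀`**
  (along the axis `dΦ(ε₀) = c'`);
* `covariantDerivAlong_mfderiv_tubeMap_axis_normal_unit` — **`D_t(e z)(x₁)` for `z ⊥ ε₀`,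
  `u = ε₀`** (symmetry lemma `D_s ∂_t = D_t ∂_s`).

Hence `∂_z G = 0` on the axis for `z, u, w` all normal (Lee 5.26 (e),
`hasDerivAt_val_mfderiv_tubeMap_axis_normal`), and the remaining first derivatives of `G` on the
axis are expressed through the acceleration `D_t c'` and the frame derivatives `D_t(e u)` — the
first-order structure of the tube metric around Weinstein's arc (Weinstein 1968, proof of the main
theorem, step (2)), bounded by the geodesic curvature of the arc for a relatively parallel frame.

## References

* J. M. Lee, *Introduction to Riemannian Manifolds*, 2nd ed., Springer GTM 176 (2018),
  Prop. 5.26 (d), (e). [cite: LeeRiemannianManifolds2018, Prop. 5.26]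
* A. Weinstein, Ann. of Math. (2) 87 (1968), 29–41. [cite: Weinstein1968]

Tags: [FermiCoordinates] [TubeMap] [Weinstein1968]
-/

noncomputable section

open Bundle Set Filter Function
open scoped Manifold ContDiff Topology RealInnerProductSpace

namespace Literature.Geometry.Riemannian

open Literature.Geometry.Lorentzian
open Literature.Geometry.Lorentzian.PseudoRiemannianMetric

variable {V : Type*} [NormedAddCommGroup V] [InnerProductSpace ℝ V]
  {E : Type*} [NormedAddCommGroup E] [NormedSpace ℝ E] {H : Type*} [TopologicalSpace H]
  {I : ModelWithCorners ℝ E H} {M : Type*} [TopologicalSpace M] [ChartedSpace H M]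
  [IsManifold I ∞ M] [FiniteDimensional ℝ E] [CompleteSpace E] [T2Space M] [BoundarylessManifold I M]
  {cov : CovariantDerivative I E (TangentSpace I : M → Type _)}
  [CovariantDerivative.ContMDiffCovariantDerivative cov 1]
  [CovariantDerivative.ContMDiffCovariantDerivative cov ((⊤ : ℕ∞) : ℕ∞ω)]
  {c : ℝ → M} {e : Π t : ℝ, V →L[ℝ] TangentSpace I (c t)} {ε₀ : V}

/-! ### The partial velocities of the slices `(s, t) ↦ Φ(v + sz + tu)` -/

/-- The `t`-velocity at `t = 0` of the slice `(s, t) ↦ Φ(v + sz + tu)` is `dΦ_{v+sz}(u)`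
(chain rule along the line). [folklore] -/
theorem velocity_tubeMap_slice (hc : IsGeodesicallyComplete cov)
    (hs : ContMDiff (𝓘(ℝ, ℝ).prod 𝓘(ℝ, V)) I.tangent ∞
      (fun q : ℝ × V ↦ (TotalSpace.mk' E (c q.1) (e q.1 q.2) : TangentBundle I M)))
    (v z u : V) (s : ℝ) :
    velocity I (fun t : ℝ ↦ expMap cov (c ⟪ε₀, v + s • z + t • u⟫)
        (e ⟪ε₀, v + s • z + t • u⟫ (v + s • z + t • u - ⟪ε₀, v + s • z + t • u⟫ • ε₀))) 0 =
      mfderiv 𝓘(ℝ, V) I (fun v : V ↦ expMap cov (c ⟪ε₀, v⟫) (e ⟪ε₀, v⟫ (v - ⟪ε₀, v⟫ • ε₀)))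
        (v + s • z) u :=
  velocity_comp_lineAt_zero
    (((contMDiff_tubeMap (cov := cov) hc hs) _).mdifferentiableAt (by simp)) u

/-- The slices are `C^∞` jointly in `(t, s)`. [folklore] -/
theorem contMDiff_uncurry_tubeMap_slice (hc : IsGeodesicallyComplete cov)
    (hs : ContMDiff (𝓘(ℝ, ℝ).prod 𝓘(ℝ, V)) I.tangent ∞
      (fun q : ℝ × V ↦ (TotalSpace.mk' E (c q.1) (e q.1 q.2) : TangentBundle I M)))
    (v z u : V) :
    ContMDiff (𝓘(ℝ, ℝ).prod 𝓘(ℝ, ℝ)) I ∞ (uncurry fun t s : ℝ ↦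
      expMap cov (c ⟪ε₀, v + s • z + t • u⟫)
        (e ⟪ε₀, v + s • z + t • u⟫ (v + s • z + t • u - ⟪ε₀, v + s • z + t • u⟫ • ε₀))) := by
  have hA : ContMDiff (𝓘(ℝ, ℝ).prod 𝓘(ℝ, ℝ)) 𝓘(ℝ, V) ∞
      (fun q : ℝ × ℝ ↦ v + q.2 • z + q.1 • u) :=
    (contMDiff_const.add (contMDiff_snd.smul contMDiff_const)).add
      (contMDiff_fst.smul contMDiff_const)
  exact (contMDiff_tubeMap (cov := cov) hc hs).comp hA

/-! ### On the axis: the four cases -/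

/-- **Normal–normal: `D_s(dΦ_{x₁ε₀ + sz} u)|₀ = 0` for `z, u ⊥ ε₀`** (Lee 2018, Prop. 5.26 (d)):
`Φ(x₁ε₀ + sz + tu) = exp_{c x₁}(s e z + t e u)`, so the field `s ↦ dΦ_{x₁ε₀+sz}(u)` along
`s ↦ exp_{c x₁}(s e z)` is `s ↦ d(exp_{c x₁})_{s e z}(e u)`, whose covariant derivative at `0`
vanishes (`covariantDerivAlong_mfderiv_expMap_zero`).
[cite: LeeRiemannianManifolds2018, Prop. 5.26 (d)] -/
theorem covariantDerivAlong_mfderiv_tubeMap_axis_normal_normal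
    (hcov₁ : cov.IsLocallyContMDiff 1) (hcov : cov.IsLocallyContMDiff ∞) (htors : cov.torsion = 0)
    (hc : IsGeodesicallyComplete cov)
    (hs : ContMDiff (𝓘(ℝ, ℝ).prod 𝓘(ℝ, V)) I.tangent ∞
      (fun q : ℝ × V ↦ (TotalSpace.mk' E (c q.1) (e q.1 q.2) : TangentBundle I M)))
    (hε₀ : ‖ε₀‖ = 1) (x₁ : ℝ) {z u : V} (hz : ⟪ε₀, z⟫ = 0) (hu : ⟪ε₀, u⟫ = 0) :
    covariantDerivAlong cov
      (fun s : ℝ ↦ expMap cov (c ⟪ε₀, x₁ • ε₀ + s • z⟫)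
        (e ⟪ε₀, x₁ • ε₀ + s • z⟫ (x₁ • ε₀ + s • z - ⟪ε₀, x₁ • ε₀ + s • z⟫ • ε₀)))
      (fun s : ℝ ↦ mfderiv 𝓘(ℝ, V) I
        (fun v : V ↦ expMap cov (c ⟪ε₀, v⟫) (e ⟪ε₀, v⟫ (v - ⟪ε₀, v⟫ • ε₀))) (x₁ • ε₀ + s • z) u)
      0 = 0 := by
  set Φ : V → M := fun v : V ↦ expMap cov (c ⟪ε₀, v⟫) (e ⟪ε₀, v⟫ (v - ⟪ε₀, v⟫ • ε₀)) with hΦ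
  have hΦd : ∀ v, MDifferentiableAt 𝓘(ℝ, V) I Φ v := fun v ↦
    ((contMDiff_tubeMap (cov := cov) hc hs) v).mdifferentiableAt (by simp)
  set y : M := c x₁ with hy
  set a : TangentSpace I y := e x₁ z with ha
  set b : TangentSpace I y := e x₁ u with hb
  set f : E → M := fun w : E ↦ expMap cov y (show TangentSpace I y from w) with hf
  have hfd : ∀ w : E, MDifferentiableAt 𝓘(ℝ, E) I f w := fun w ↦
    ((contMDiff_expMap_of_isGeodesicallyComplete (cov := cov) (k := (⊤ : ℕ∞)) le_top hc y) w
      ).mdifferentiableAt (by simp)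
  -- the slice through `e`: `Φ(x₁ε₀ + sz + tu) = f(s a + t b)`
  have hslice : ∀ s t : ℝ, Φ (x₁ • ε₀ + s • z + t • u) = f (s • (a : E) + t • (b : E)) := by
    intro s t
    have h1 : ⟪ε₀, x₁ • ε₀ + s • z + t • u⟫ = x₁ := by
      rw [inner_add_right, inner_smul_unit_add hε₀ hz, inner_smul_right, hu, mul_zero, add_zero]
    have h2 : x₁ • ε₀ + s • z + t • u - x₁ • ε₀ = s • z + t • u := by abel
    have key : ∀ r : ℝ, r = x₁ →
        expMap cov (c r) (e r (x₁ • ε₀ + s • z + t • u - r • ε₀)) = f (s • (a : E) + t • (b : E)) := by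
      rintro r rfl
      rw [h2, map_add, map_smul, map_smul]
    exact key _ h1
  -- the curve and the field, as the radial geodesic and the normal-chart field of `NormalCoordinatesCenter`
  have hcurve : (fun s : ℝ ↦ Φ (x₁ • ε₀ + s • z)) = fun s : ℝ ↦ expMap cov y (s • a) := by
    funext s
    have h := hslice s 0
    rw [zero_smul, add_zero, zero_smul, add_zero] at h
    exact h
  have hfield : (fun s : ℝ ↦ (mfderiv 𝓘(ℝ, V) I Φ (x₁ • ε₀ + s • z) u : E)) =
      fun s : ℝ ↦ (mfderiv 𝓘(ℝ, E) I f (s • (a : E)) (b : E) : E) := by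
    funext s
    rw [← velocity_comp_lineAt_zero (hΦd _) u, ← velocity_comp_lineAt_zero (hfd _) (b : E)]
    have hfun : (fun t : ℝ ↦ Φ (x₁ • ε₀ + s • z + t • u)) =
        fun t : ℝ ↦ f (s • (a : E) + t • (b : E)) := funext fun t ↦ hslice s t
    rw [hfun]
    rfl
  have key := covariantDerivAlong_mfderiv_expMap_zero (cov := cov) hcov₁ hcov htors hc y a b
  show covariantDerivAlong cov (fun s : ℝ ↦ Φ (x₁ • ε₀ + s • z))
    (fun s : ℝ ↦ mfderiv 𝓘(ℝ, V) I Φ (x₁ • ε₀ + s • z) u) 0 = 0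
  rw [hfield, hcurve]
  exact key

/-- **Unit–normal: `D_s(dΦ_{(x₁+s)ε₀} u)|₀ = D_t(e u)(x₁)` for `u ⊥ ε₀`**: along the axis the
tube map is the curve and `dΦ(u) = e(·) u` (`mfderiv_tubeMap_axis_apply_of_inner_eq_zero`); the
reparametrisation `s ↦ x₁ + s` does not change the covariant derivative
(`covariantDerivAlong_comp_affine`). [cite: LeeRiemannianManifolds2018, Prop. 5.26] -/
theorem covariantDerivAlong_mfderiv_tubeMap_axis_unit_normal (hc : IsGeodesicallyComplete cov)
    (hs : ContMDiff (𝓘(ℝ, ℝ).prod 𝓘(ℝ, V)) I.tangent ∞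
      (fun q : ℝ × V ↦ (TotalSpace.mk' E (c q.1) (e q.1 q.2) : TangentBundle I M)))
    (hε₀ : ‖ε₀‖ = 1) (x₁ : ℝ) {u : V} (hu : ⟪ε₀, u⟫ = 0) :
    covariantDerivAlong cov
      (fun s : ℝ ↦ expMap cov (c ⟪ε₀, x₁ • ε₀ + s • ε₀⟫)
        (e ⟪ε₀, x₁ • ε₀ + s • ε₀⟫ (x₁ • ε₀ + s • ε₀ - ⟪ε₀, x₁ • ε₀ + s • ε₀⟫ • ε₀)))
      (fun s : ℝ ↦ mfderiv 𝓘(ℝ, V) I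
        (fun v : V ↦ expMap cov (c ⟪ε₀, v⟫) (e ⟪ε₀, v⟫ (v - ⟪ε₀, v⟫ • ε₀))) (x₁ • ε₀ + s • ε₀) u)
      0 = covariantDerivAlong cov c (fun t ↦ e t u) x₁ := by
  set Φ : V → M := fun v : V ↦ expMap cov (c ⟪ε₀, v⟫) (e ⟪ε₀, v⟫ (v - ⟪ε₀, v⟫ • ε₀)) with hΦ
  have hadd : ∀ s : ℝ, x₁ • ε₀ + s • ε₀ = (1 * s + x₁) • ε₀ := fun s ↦ by
    rw [← add_smul]; congr 1; ring
  have hcurve : (fun s : ℝ ↦ Φ (x₁ • ε₀ + s • ε₀)) = fun s : ℝ ↦ c (1 * s + x₁) := by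
    funext s
    rw [hadd s]
    exact tubeMap_axis (cov := cov) (e := e) hε₀ _
  have hfield : (fun s : ℝ ↦ (mfderiv 𝓘(ℝ, V) I Φ (x₁ • ε₀ + s • ε₀) u : E)) =
      fun s : ℝ ↦ (e (1 * s + x₁) u : E) := by
    funext s
    rw [hadd s]
    exact mfderiv_tubeMap_axis_apply_of_inner_eq_zero (cov := cov) hc hs hε₀ _ hu
  show covariantDerivAlong cov (fun s : ℝ ↦ Φ (x₁ • ε₀ + s • ε₀))
    (fun s : ℝ ↦ mfderiv 𝓘(ℝ, V) I Φ (x₁ • ε₀ + s • ε₀) u) 0 = _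
  rw [hfield, hcurve, covariantDerivAlong_comp_affine (cov := cov) c (fun t ↦ e t u) 1 x₁ 0, one_smul]
  have key : ∀ t : ℝ, t = x₁ →
      (covariantDerivAlong cov c (fun t ↦ e t u) t : E) = covariantDerivAlong cov c (fun t ↦ e t u) x₁ := by
    rintro t rfl
    rfl
  exact key _ (by ring)

/-- **Unit–unit: `D_s(dΦ_{(x₁+s)ε₀} ε₀)|₀ = D_t c'(x₁)`** — the acceleration of the curve: along
the axis `dΦ(ε₀) = c'` (`mfderiv_tubeMap_axis_apply_unit`).
[cite: LeeRiemannianManifolds2018, Prop. 5.26] -/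
theorem covariantDerivAlong_mfderiv_tubeMap_axis_unit_unit (hc : IsGeodesicallyComplete cov)
    (hs : ContMDiff (𝓘(ℝ, ℝ).prod 𝓘(ℝ, V)) I.tangent ∞
      (fun q : ℝ × V ↦ (TotalSpace.mk' E (c q.1) (e q.1 q.2) : TangentBundle I M)))
    (hε₀ : ‖ε₀‖ = 1) (x₁ : ℝ) :
    covariantDerivAlong cov
      (fun s : ℝ ↦ expMap cov (c ⟪ε₀, x₁ • ε₀ + s • ε₀⟫)
        (e ⟪ε₀, x₁ • ε₀ + s • ε₀⟫ (x₁ • ε₀ + s • ε₀ - ⟪ε₀, x₁ • ε₀ + s • ε₀⟫ • ε₀)))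
      (fun s : ℝ ↦ mfderiv 𝓘(ℝ, V) I
        (fun v : V ↦ expMap cov (c ⟪ε₀, v⟫) (e ⟪ε₀, v⟫ (v - ⟪ε₀, v⟫ • ε₀))) (x₁ • ε₀ + s • ε₀) ε₀)
      0 = covariantDerivAlong cov c (fun t ↦ velocity I c t) x₁ := by
  set Φ : V → M := fun v : V ↦ expMap cov (c ⟪ε₀, v⟫) (e ⟪ε₀, v⟫ (v - ⟪ε₀, v⟫ • ε₀)) with hΦ
  have hadd : ∀ s : ℝ, x₁ • ε₀ + s • ε₀ = (1 * s + x₁) • ε₀ := fun s ↦ by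
    rw [← add_smul]; congr 1; ring
  have hcurve : (fun s : ℝ ↦ Φ (x₁ • ε₀ + s • ε₀)) = fun s : ℝ ↦ c (1 * s + x₁) := by
    funext s
    rw [hadd s]
    exact tubeMap_axis (cov := cov) (e := e) hε₀ _
  have hfield : (fun s : ℝ ↦ (mfderiv 𝓘(ℝ, V) I Φ (x₁ • ε₀ + s • ε₀) ε₀ : E)) =
      fun s : ℝ ↦ (velocity I c (1 * s + x₁) : E) := by
    funext s
    rw [hadd s]
    exact mfderiv_tubeMap_axis_apply_unit (cov := cov) hc hs hε₀ _
  show covariantDerivAlong cov (fun s : ℝ ↦ Φ (x₁ • ε₀ + s • ε₀))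
    (fun s : ℝ ↦ mfderiv 𝓘(ℝ, V) I Φ (x₁ • ε₀ + s • ε₀) ε₀) 0 = _
  rw [hfield, hcurve, covariantDerivAlong_comp_affine (cov := cov) c (fun t ↦ velocity I c t) 1 x₁ 0,
    one_smul]
  have key : ∀ t : ℝ, t = x₁ → (covariantDerivAlong cov c (fun t ↦ velocity I c t) t : E) =
      covariantDerivAlong cov c (fun t ↦ velocity I c t) x₁ := by
    rintro t rfl
    rfl
  exact key _ (by ring)

/-- **Normal–unit: `D_s(dΦ_{x₁ε₀ + sz} ε₀)|₀ = D_t(e z)(x₁)` for `z ⊥ ε₀`** — by the symmetry lemma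
`D_s ∂_t = D_t ∂_s` for the slice `(s, t) ↦ Φ(x₁ε₀ + sz + tε₀)` this is the unit–normal case.
[cite: LeeRiemannianManifolds2018, Prop. 5.26] -/
theorem covariantDerivAlong_mfderiv_tubeMap_axis_normal_unit (htors : cov.torsion = 0)
    (hc : IsGeodesicallyComplete cov)
    (hs : ContMDiff (𝓘(ℝ, ℝ).prod 𝓘(ℝ, V)) I.tangent ∞
      (fun q : ℝ × V ↦ (TotalSpace.mk' E (c q.1) (e q.1 q.2) : TangentBundle I M)))
    (hε₀ : ‖ε₀‖ = 1) (x₁ : ℝ) {z : V} (hz : ⟪ε₀, z⟫ = 0) :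
    covariantDerivAlong cov
      (fun s : ℝ ↦ expMap cov (c ⟪ε₀, x₁ • ε₀ + s • z⟫)
        (e ⟪ε₀, x₁ • ε₀ + s • z⟫ (x₁ • ε₀ + s • z - ⟪ε₀, x₁ • ε₀ + s • z⟫ • ε₀)))
      (fun s : ℝ ↦ mfderiv 𝓘(ℝ, V) I
        (fun v : V ↦ expMap cov (c ⟪ε₀, v⟫) (e ⟪ε₀, v⟫ (v - ⟪ε₀, v⟫ • ε₀))) (x₁ • ε₀ + s • z) ε₀)
      0 = covariantDerivAlong cov c (fun t ↦ e t z) x₁ := by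
  set Φ : V → M := fun v : V ↦ expMap cov (c ⟪ε₀, v⟫) (e ⟪ε₀, v⟫ (v - ⟪ε₀, v⟫ • ε₀)) with hΦ
  have hΦd : ∀ v, MDifferentiableAt 𝓘(ℝ, V) I Φ v := fun v ↦
    ((contMDiff_tubeMap (cov := cov) hc hs) v).mdifferentiableAt (by simp)
  -- the slice `x(s, t) = Φ(x₁ε₀ + sz + tε₀)` and the symmetry lemma at `(0, 0)`
  set x : ℝ → ℝ → M := fun s t ↦ Φ (x₁ • ε₀ + s • z + t • ε₀) with hx
  have hxs : ContMDiff (𝓘(ℝ, ℝ).prod 𝓘(ℝ, ℝ)) I ∞ (uncurry x) := by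
    have hA : ContMDiff (𝓘(ℝ, ℝ).prod 𝓘(ℝ, ℝ)) 𝓘(ℝ, V) ∞
        (fun q : ℝ × ℝ ↦ x₁ • ε₀ + q.1 • z + q.2 • ε₀) :=
      (contMDiff_const.add (contMDiff_fst.smul contMDiff_const)).add
        (contMDiff_snd.smul contMDiff_const)
    exact (contMDiff_tubeMap (cov := cov) hc hs).comp hA
  have h2 : (2 : ℕ∞ω) ≤ ∞ := WithTop.coe_le_coe.2 le_top
  have hsymm := covariantDerivAlong_velocity_comm cov htors ((hxs (0, 0)).of_le h2)
  -- left side: the field `s ↦ ∂_t x(s, 0) = dΦ_{x₁ε₀+sz}(ε₀)`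
  have hL : (fun s : ℝ ↦ velocity I (x s) 0) =
      fun s : ℝ ↦ (mfderiv 𝓘(ℝ, V) I Φ (x₁ • ε₀ + s • z) ε₀ : E) := by
    funext s
    exact velocity_comp_lineAt_zero (hΦd _) ε₀
  have hLc : (fun s : ℝ ↦ x s 0) = fun s : ℝ ↦ Φ (x₁ • ε₀ + s • z) := by
    funext s
    simp only [hx, zero_smul, add_zero]
  -- right side: the curve `t ↦ x(0, t) = c(x₁ + t)` and the field `t ↦ ∂_s x(0, t) = e(x₁+t) z`
  have hadd : ∀ t : ℝ, x₁ • ε₀ + t • ε₀ = (1 * t + x₁) • ε₀ := fun t ↦ by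
    rw [← add_smul]; congr 1; ring
  have hRc : x 0 = fun t : ℝ ↦ c (1 * t + x₁) := by
    funext t
    simp only [hx, zero_smul, add_zero]
    rw [hadd t]
    exact tubeMap_axis (cov := cov) (e := e) hε₀ _
  have hR : (fun t : ℝ ↦ velocity I (fun s ↦ x s t) 0) = fun t : ℝ ↦ (e (1 * t + x₁) z : E) := by
    funext t
    have h1 : (fun s ↦ x s t) = fun s : ℝ ↦ Φ ((x₁ • ε₀ + t • ε₀) + s • z) := by
      funext s
      simp only [hx]
      congr 1
      abel
    rw [h1, velocity_comp_lineAt_zero (hΦd _) z, hadd t]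
    exact mfderiv_tubeMap_axis_apply_of_inner_eq_zero (cov := cov) hc hs hε₀ _ hz
  show covariantDerivAlong cov (fun s : ℝ ↦ Φ (x₁ • ε₀ + s • z))
    (fun s : ℝ ↦ mfderiv 𝓘(ℝ, V) I Φ (x₁ • ε₀ + s • z) ε₀) 0 = _
  rw [← hLc, ← hL, hsymm, hR, hRc,
    covariantDerivAlong_comp_affine (cov := cov) c (fun t ↦ e t z) 1 x₁ 0, one_smul]
  have key : ∀ t : ℝ, t = x₁ →
      (covariantDerivAlong cov c (fun t ↦ e t z) t : E) = covariantDerivAlong cov c (fun t ↦ e t z) x₁ := by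
    rintro t rfl
    rfl
  exact key _ (by ring)

/-! ### The first derivatives of the pulled-back metric -/

variable {n : ℕ∞ω} [Fact (1 ≤ n)]
  (g : PseudoRiemannianMetric I n E (TangentSpace I : M → Type _)) [g.HasLeviCivita]
  [CovariantDerivative.ContMDiffCovariantDerivative g.leviCivita 1]
  [CovariantDerivative.ContMDiffCovariantDerivative g.leviCivita ((⊤ : ℕ∞) : ℕ∞ω)]

omit [CovariantDerivative.ContMDiffCovariantDerivative cov 1]
  [CovariantDerivative.ContMDiffCovariantDerivative cov ((⊤ : ℕ∞) : ℕ∞ω)] in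
/-- **`∂_z G(u, w) = g(D_s(dΦ u), dΦ w) + g(dΦ u, D_s(dΦ w))`** — the derivative at `s = 0` of
`s ↦ g(dΦ_{v+sz} u, dΦ_{v+sz} w)` along the curve `s ↦ Φ(v + sz)`, by metric compatibility
(`hasDerivAt_val_apply_along`); the fields `s ↦ dΦ_{v+sz}(u)` are the partial velocities
`∂_t|₀ Φ(v + sz + tu)` of `C^∞` two-parameter maps, so their lifts are differentiable
(`mdifferentiableAt_lift_velocity_curry_left`). [folklore] -/
theorem hasDerivAt_val_mfderiv_tubeMap (hgc : IsGeodesicallyComplete g.leviCivita)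
    (hs : ContMDiff (𝓘(ℝ, ℝ).prod 𝓘(ℝ, V)) I.tangent ∞
      (fun q : ℝ × V ↦ (TotalSpace.mk' E (c q.1) (e q.1 q.2) : TangentBundle I M)))
    (v z u w : V) :
    HasDerivAt (fun s : ℝ ↦
      g.val (expMap g.leviCivita (c ⟪ε₀, v + s • z⟫)
          (e ⟪ε₀, v + s • z⟫ (v + s • z - ⟪ε₀, v + s • z⟫ • ε₀)))
        (mfderiv 𝓘(ℝ, V) I (fun v : V ↦ expMap g.leviCivita (c ⟪ε₀, v⟫)
          (e ⟪ε₀, v⟫ (v - ⟪ε₀, v⟫ • ε₀))) (v + s • z) u)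
        (mfderiv 𝓘(ℝ, V) I (fun v : V ↦ expMap g.leviCivita (c ⟪ε₀, v⟫)
          (e ⟪ε₀, v⟫ (v - ⟪ε₀, v⟫ • ε₀))) (v + s • z) w))
      (g.val (expMap g.leviCivita (c ⟪ε₀, v + (0 : ℝ) • z⟫)
          (e ⟪ε₀, v + (0 : ℝ) • z⟫ (v + (0 : ℝ) • z - ⟪ε₀, v + (0 : ℝ) • z⟫ • ε₀)))
        (covariantDerivAlong g.leviCivita
          (fun s : ℝ ↦ expMap g.leviCivita (c ⟪ε₀, v + s • z⟫)
            (e ⟪ε₀, v + s • z⟫ (v + s • z - ⟪ε₀, v + s • z⟫ • ε₀)))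
          (fun s : ℝ ↦ mfderiv 𝓘(ℝ, V) I (fun v : V ↦ expMap g.leviCivita (c ⟪ε₀, v⟫)
            (e ⟪ε₀, v⟫ (v - ⟪ε₀, v⟫ • ε₀))) (v + s • z) u) 0)
        (mfderiv 𝓘(ℝ, V) I (fun v : V ↦ expMap g.leviCivita (c ⟪ε₀, v⟫)
          (e ⟪ε₀, v⟫ (v - ⟪ε₀, v⟫ • ε₀))) (v + (0 : ℝ) • z) w) +
      g.val (expMap g.leviCivita (c ⟪ε₀, v + (0 : ℝ) • z⟫)
          (e ⟪ε₀, v + (0 : ℝ) • z⟫ (v + (0 : ℝ) • z - ⟪ε₀, v + (0 : ℝ) • z⟫ • ε₀)))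
        (mfderiv 𝓘(ℝ, V) I (fun v : V ↦ expMap g.leviCivita (c ⟪ε₀, v⟫)
          (e ⟪ε₀, v⟫ (v - ⟪ε₀, v⟫ • ε₀))) (v + (0 : ℝ) • z) u)
        (covariantDerivAlong g.leviCivita
          (fun s : ℝ ↦ expMap g.leviCivita (c ⟪ε₀, v + s • z⟫)
            (e ⟪ε₀, v + s • z⟫ (v + s • z - ⟪ε₀, v + s • z⟫ • ε₀)))
          (fun s : ℝ ↦ mfderiv 𝓘(ℝ, V) I (fun v : V ↦ expMap g.leviCivita (c ⟪ε₀, v⟫)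
            (e ⟪ε₀, v⟫ (v - ⟪ε₀, v⟫ • ε₀))) (v + s • z) w) 0)) 0 := by
  have hLC := isLeviCivita_leviCivita_holds (g := g)
  have hcompat : g.IsCompatible g.leviCivita := hLC.2
  set Φ : V → M := fun v : V ↦ expMap g.leviCivita (c ⟪ε₀, v⟫) (e ⟪ε₀, v⟫ (v - ⟪ε₀, v⟫ • ε₀))
    with hΦ
  have hΦd : ∀ v, MDifferentiableAt 𝓘(ℝ, V) I Φ v := fun v ↦
    ((contMDiff_tubeMap (cov := g.leviCivita) hgc hs) v).mdifferentiableAt (by simp)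
  -- the lifts of `s ↦ dΦ_{v+sz}(u)` are differentiable at `0`
  have hlift : ∀ u : V, MDifferentiableAt 𝓘(ℝ, ℝ) I.tangent
      (fun s : ℝ ↦ (TotalSpace.mk' E (Φ (v + s • z))
        (mfderiv 𝓘(ℝ, V) I Φ (v + s • z) u) : TangentBundle I M)) 0 := by
    intro u
    set x : ℝ → ℝ → M := fun t s ↦ Φ (v + s • z + t • u) with hx
    have hxs := contMDiff_uncurry_tubeMap_slice (cov := g.leviCivita) (ε₀ := ε₀) hgc hs v z u
    have h2 : (2 : ℕ∞ω) ≤ ∞ := WithTop.coe_le_coe.2 le_top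
    have h := mdifferentiableAt_lift_velocity_curry_left ((hxs (0, 0)).of_le h2)
    have hfun : (fun s : ℝ ↦ (TotalSpace.mk' E (x 0 s) (velocity I (fun t ↦ x t s) 0) :
        TangentBundle I M)) =
        fun s : ℝ ↦ (TotalSpace.mk' E (Φ (v + s • z)) (mfderiv 𝓘(ℝ, V) I Φ (v + s • z) u) :
          TangentBundle I M) := by
      funext s
      have hb : x 0 s = Φ (v + s • z) := by simp only [hx, zero_smul, add_zero]
      have hv' : (velocity I (fun t ↦ x t s) 0 : E) = mfderiv 𝓘(ℝ, V) I Φ (v + s • z) u :=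
        velocity_comp_lineAt_zero (hΦd _) u
      revert hv'
      rw [show (fun t ↦ x t s) = fun t : ℝ ↦ Φ (v + s • z + t • u) from rfl]
      intro hv'
      exact totalSpace_mk_eq' hb hv'
    rw [hfun] at h
    exact h
  exact g.hasDerivAt_val_apply_along hcompat (hlift u) (hlift w)
where
  /-- Equality of points of `TM` from equality of base points and of the vectors read in `E`. -/
  totalSpace_mk_eq' {p p' : M} (hp : p = p') {a : TangentSpace I p} {a' : TangentSpace I p'}
      (ha : (a : E) = a') : (TotalSpace.mk' E p a : TangentBundle I M) = TotalSpace.mk' E p' a' := by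
    subst hp
    have ha' : a = a' := ha
    rw [ha']

end Literature.Geometry.Riemannian

end
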